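import Literature.MathematicalPhysics.QuantumFieldTheory.Balaban1983to89.B8Prop6DentedCubeMemberGammaPrecompProp6Rec
import Literature.MathematicalPhysics.QuantumFieldTheory.Balaban1983to89.B8Thm4ExistsAtGammaGRec

/-!
# `Balaban1983to89.B8Prop6DentedCubeMemberGammaGPrecompRec` — [Balaban1985RegularSpaces] PROPOSITION 6 (p. 99) ∕ [Balaban1985Variational] (152)–(153) AT THE DENTED RECORD CUBE
# MEMBER FOR THE PRE-COMPOSED THEOREM-4 INPUT `(U₀″)^{h}`, MODULO THE THREE EXISTENCE BODIES, EDITION γ, CENTRED AVERAGING ([Balaban1987RG1] (0.4)) **WITH THE GAUGE-GROUP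
# INVARIANT**: `U₀`, `h`, `u`, `w′ = v⁻¹h⁻¹u` `G`-VALUED for an averaging-closed `G ≤ U(𝔸)` ([Balaban1985Averaging] p. 20; print's case of record `G = SU(N)`) — the `G`-form of
# the pre-composed crown root ✓`B8Prop6DentedCubeMemberGammaPrecompProp6Rec.prop6_exists_dentedMember_precomposed_at_γ₃` (item (B′-4)·4 of the plan's road (B′), pen dag-n05-e g42)

statement-level skeleton of published theorems with citation tags; proofs where landed; nothing here is a claim about the Yang–Mills mass gap

T. Bałaban, *Spaces of regular gauge field configurations on a lattice and gauge fixing conditions*, Commun. Math. Phys. **99** (1985) 75–102 `[Balaban1985RegularSpaces]`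
("[6]"): Prop. 6 (1.135)–(1.136) p. 99, p. 99 (sentence after (1.133)), Thm 4 p. 88, Prop. 5 (1.107)–(1.108) p. 94, (1.58)–(1.59) p. 86, (1.31) p. 82, (1.29) p. 81, p. 76
(«G = SU(N)»); T. Bałaban, *The variational problem and background fields in renormalization group method for lattice gauge theories*, CMP **102** (1985) 277–309
`[Balaban1985Variational]` ("[15]"): (148)–(153) p. 301; T. Bałaban, *Averaging operations for lattice gauge theories*, CMP **98** (1985) 17–51 `[Balaban1985Averaging]`
("[3]"): p. 20, (42)–(43) pp. 23–24; [I] = T. Bałaban, *Renormalization group approach to lattice gauge field theories. I*, CMP **109** (1987) 249–301 `[Balaban1987RG1]`: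
(0.3)–(0.4), (0.6) pp. 252–253.  STATUS: published, refereed.

CITATION HEADER (lean-in-tree rule).  Cell `pub-ymgap` (HUMAN RULING D-0062, Track A), «N05-REC» road, ROAD (B′) = director-ym №310–№312a branch (ii) case (β) («axiality-
preserving block-constant pre-composition of the Theorem-4 input»; licence line: variant, our proof — NOT a printed clause); LEAD PEN dag-n05-e g42.  WHY THIS FILE.  The
`G`-chain of the record crown (G4 `…GammaGRec` → G5 `…FlatScalarGammaGRec` → `…GaugedRealGammaGRec` → G7 `…ScalarGammaOfNamedFactsGRec` → G8 `…ScalarGammaSU25Rec`) roots on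
the `G`-form of the Prop-6 existence theorem; g41's pre-composed root ✓p746506 is the UNITARY form.  THIS FILE is the SAME pre-composed theorem over the `G`-driver
`B8Thm4ExistsAtGammaGRec.thm4Exists_concrete_at_γ_mem`: statement byte for byte ✓p746506's with `(G : Subgroup 𝔸ˣ) (hG : G ≤ unitaryUnits 𝔸) (hGavg : AvgClosedZ d L G)`
added, `U₀` AND `h` `G`-valued, the two Proposition-5 bodies read with `v x ∈ G` ∕ `u₁ x ∈ G`, and the conclusion's memberships `u x ∈ G`, `(v⁻¹·(h⁻¹·u)) x ∈ G`
(`v = localGaugeZ …` is `G`-valued by `B8Prop6OfThm4Rec.localGaugeZ_mem` under `AvgClosedZ d L G`); the «assumptions of Theorem 4» package for `(U₀″)^h` is (B′-4)·2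
✓`B8Prop6DentedCubeMemberGammaPrecompRec.thm4_hypotheses_one_precomposed_dented_γ` BY NAME; proof = ✓p746506's, five tokens changed.  Consumers: the pre-composed crown files
F2–F8 of this run (`…GaugedPrecompRec`, `…NormsGammaPrecompRec`, `…NormsFlatGammaPrecompRec`, `…FlatScalarGammaGPrecompRec`, `…GaugedRealGammaGPrecompRec`,
`…ScalarGammaOfNamedFactsGPrecompRec`, `…ScalarGammaSU25PrecompRec`).  Kind «kernel-checked proof», ONE theorem; no `def`, no `instance`, no `notation`, no existing module
modified.  `--kind proof --supports stmt-QuantumFields-20541` (K0⁷-keyed, COUNT-NEUTRAL).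

HONEST SCOPE.  A driver call; NO new estimate; nothing of Theorem 4 ∕ Prop. 5 ∕ (1.59) proved (the three bodies are hypotheses); `HThm4Rec*` CONDITIONAL; N05 DISCHARGED OF
RECORD since R467 (count-neutral record-level work), N07 NOT discharged; counts unmoved (typed 28∕28 · discharged 8∕28); one finite 𝕋⁴ programme at fixed ε, `G = SU(2)` of
record — nothing continuum ∕ ℝ⁴ ∕ OS ∕ mass gap ∕ Clay.  No `sorry`, no `def`.
-/

set_option autoImplicit false

noncomputable section

namespace Literature.MathematicalPhysics.QuantumFieldTheory.Balaban1983to89.B8Prop6DentedCubeMemberGammaGPrecompRec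

open B7Prop1Explicit B7Prop2Explicit B7Prop1Local
open B7Eq92Concrete (mgauge mgauge_apply mgauge_one_left)
open B7Prop2Explicit (c2' unitaryUnits unitaryUnits_le_U1)
open B7Prop2Rec (AvgClosedZ C0Z avgClosedZ_unitaryUnits)
open B7AvgGaugeCovariance (uLev)
open BlockAveragingZd (avgIterZ ctrShift)
open B7SectEFLinearisationRec (linCovIterZ)
open B8Ineq130Rec (tlo thi tlo_le_thi)
open B8Ineq132 (covDerivFwd InAk BondTouches condAt_anti)
open B8Ineq132Rec (pdevOn_lt_of_inAk_box)
open B8Ineq133Rec (cutFixedZ)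
open B8Eq115GaugeFixing (gaugeAct_mul)
open B8Eq115GaugeFixingRec (localGaugeZ)
open B8Eq119TwistedAxialRec (InAxZ Restr129Z UnderZ)
open B8Eq184Proof (gaugeExp cfgExp)
open B8Lemma1NonAbelian (mulCfg)
open B8Eq140Level (SideTouches)
open B8Eq146AExpansion (iEta)
open B8Eq155JBound (Jcur wsup)
open B8ScaledSupNorm (bondNorm msup)
open B8Eq138LandauZd (logCfg)
open B8Eq138LandauZdRec (IsLandau138WZ)
open B8Eq131Cubes (tLo tHi ctr tLo_le_tHi)
open B8Prop6OfThm4 (agree135)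
open B8Prop6OfThm4Rec (localGaugeZ_mem)
open B8Thm4ExistsAtGammaGRec (thm4Exists_concrete_at_γ_mem)
open B9SupplySockB9P3ZdBeta (CrossB)
open B8DentedCubeMemberZdRec (lamST_top_apply hΩ_sq lamBPT_hbox_pred lamBPT_hclass bdryLayer_dented)
open B8Prop6DentedCubeMemberGammaPrecompRec (thm4_hypotheses_one_precomposed_dented_γ)
open Node00 (CubeB8DZ)

export B7Prop1Explicit (Site)

variable {d : ℕ}
variable {𝔸 : Type} [CStarAlgebra 𝔸] [Nontrivial 𝔸]

/-- ★★★ (`G`-FORM of ✓`B8Prop6DentedCubeMemberGammaPrecompProp6Rec.prop6_exists_dentedMember_precomposed_at_γ₃`; pre-composed twin of dag-n07-w3's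
✓`B8Prop6DentedCubeMemberGammaGRec.prop6_exists_dentedMember_at_γ₃_mem`.) **PROPOSITION 6 (p. 99) ∕ [15] (152)–(153) AT THE DENTED RECORD CUBE MEMBER FOR THE PRE-COMPOSED
THEOREM-4 INPUT `(U₀″)^{h}`, MODULO THE THREE EXISTENCE BODIES AT THE DATUM `(1, (U₀″)^h)`, EDITION γ, CENTRED AVERAGING, WITH THE GAUGE-GROUP INVARIANT**: for an
averaging-closed subgroup `G ≤ U(𝔸)` ([3] p. 20, (42)–(43); [6] p. 76 «G = SU(N)»), ONE threshold `c₁ > 0` (the `G`-driver's `thm4Exists_concrete_at_γ_mem`); for every dented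
record datum `c`, every `G`-VALUED `U₀ ∈ 𝔄_k({Ω_j}, α₀)` in the regime of (1.130), every `G`-VALUED `h` CONSTANT `= X(j, y)` on the block tower under every dented cell `y ∈ Λ′_j`
(`1 ≤ j ≤ k`) whose oscillation across the (1.35) bonds and the level-0 collar is `≤ ω` (`0 ≤ ω`), with `L³α₀ + (6dL²Mα₀ + ω) ≤ c₁`, and the three bodies (Prop. 5 base ∕ step
`G`-valued, Theorem 4's two-member (1.59) clause) AT THE DATUM `(U₀″)^h`: THERE IS a `G`-valued `u`, `= 1` off `□₀`, with (1.29)∕(152) «ū_j = 1 on Λ′_j» for the DENTED cells,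
such that `U₁ := ((U₀″)^h)^{u⁻¹}` satisfies the Landau gauge of record (1.38)∕(153) and (1.62) (`U₁ = e^{iηA}`, `A` Hermitian, `|A_b| ≤ 5dLB₀(L³α₀ + (6dL²Mα₀ + ω))(Lʲη)⁻¹`), and
(1.135)′: `w′ := v⁻¹·h⁻¹·u` `G`-VALUED, `U₀^{w′⁻¹} = U₁` on `□̃`.  Statement byte for byte the unitary twin's with `G`-memberships (as GammaGRec does for GammaRec).
Item (B′-4)·4 of the plan's road (B′) (director-ym №310–№312a branch (ii), case (β)); the root of the `G`-valued pre-composed crown.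
[cite: Balaban1985RegularSpaces, Prop. 6 (1.135)–(1.136) p.99, p.99 (sentence after (1.133)), Thm 4 p.88, Prop. 5 (1.107)–(1.108) p.94, (1.58)–(1.59) p.86, (1.31) p.82, p.76; Balaban1985Variational, (148)–(153) p.301; Balaban1985Averaging, p.20, (42)–(43) pp.23–24; Balaban1987RG1, (0.3)–(0.4) p.253, (0.6) p.253] -/
theorem prop6_exists_dentedMember_precomposed_at_γ₃_mem (hd2 : 2 ≤ d) {L s : ℕ} (hLs : L = 2 * s + 1) (hs : 1 ≤ s)
    (G : Subgroup 𝔸ˣ) (hG : G ≤ unitaryUnits 𝔸) (hGavg : AvgClosedZ d L G) {B₀ B₀' Bbd : ℝ} (hB₀ : 0 < B₀) (hB₀' : 0 < B₀')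
    (hB : 2 ≤ 5 * (d : ℝ) * L * B₀) (hBbd : 0 ≤ Bbd) (hBd : 4 * Bbd ≤ ((d : ℝ) * L - 1) * B₀) :
    ∃ c₁ : ℝ, 0 < c₁ ∧ ∀ (η : ℝ), 0 < η → ∀ {K : ℕ} {Ω : ℕ → Set (Site d)} (c : CubeB8DZ d L K Ω),
      ∀ (U₀ : Site d → Fin d → 𝔸ˣ), (∀ x κ, U₀ x κ ∈ G) → ∀ (α₀ : ℝ), 0 < α₀ →
      C0Z d * (α₀ * (L : ℝ) ^ 2) ≤ 1 / 3 → 2 * (α₀ * (L : ℝ) ^ 2) ≤ c2' d L →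
      InAk L c.k η α₀ Ω U₀ →
      11 * (d : ℝ) ^ 2 * (L : ℝ) ^ 2 * α₀ + ((c.M : ℝ) + 4 * c.ρ) * d * (L : ℝ) ^ 2 * α₀ ≤ 1 / 6 →
      -- the pre-composition `h`: `G`-valued, constant under the dented cells, oscillation `ω`
      ∀ (h : Site d → 𝔸ˣ), (∀ x, h x ∈ G) → ∀ (X : ℕ → Site d → 𝔸ˣ),
      (∀ j, 1 ≤ j → j ≤ c.k → ∀ y ∈ c.lamS j, ∀ x, UnderZ L j y x → h x = X j y) → ∀ (ω : ℝ), 0 ≤ ω →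
      (∀ j, j ≤ c.k → ∀ (z : Site d) (μ : Fin d),
        (∀ x, InBox (fun i => (L : ℤ) ^ j * z i - (ctrShift L j : ℤ)) (fun i => (L : ℤ) ^ j * z i + (ctrShift L j : ℤ) + if i = μ then (L : ℤ) ^ j else 0) x →
          x ∈ c.sq (j - 1)) → ‖((uLev L h j z : 𝔸ˣ) : 𝔸) - ((uLev L h j (z + e μ) : 𝔸ˣ) : 𝔸)‖ ≤ ω) →
      (∀ b ∈ {b : Site d × Fin d | SideTouches (c.sq 0) b.1 b.2}, ‖((h b.1 : 𝔸ˣ) : 𝔸) - ((h (b.1 + e b.2) : 𝔸ˣ) : 𝔸)‖ ≤ ω) →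
      (L : ℝ) ^ 3 * α₀ + (6 * d * (L : ℝ) ^ 2 * c.M * α₀ + ω) ≤ c₁ →
      ((∃ (v : Site d → 𝔸ˣ) (lam : Site d → 𝔸), (∀ x, v x ∈ G) ∧ (∀ x, x ∉ c.sq 0 → v x = 1) ∧
        (∀ j, j ≤ 1 → ∀ b ∈ {b : Site d × Fin d | SideTouches (c.sq j) b.1 b.2}, (v b.1 : 𝔸) = ((gaugeExp lam b.1 : 𝔸ˣ) : 𝔸) ∧
        (v (b.1 + e b.2) : 𝔸) = ((gaugeExp lam (b.1 + e b.2) : 𝔸ˣ) : 𝔸)) ∧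
        (∀ j, j ≤ 1 → ∀ b ∈ {b : Site d × Fin d | SideTouches (c.sq j) b.1 b.2},
        ‖lam b.1‖ ≤ (8 * B₀' * (5 * (d : ℝ) * L * B₀) * (((L : ℝ) ^ 3 * α₀) + (6 * d * (L : ℝ) ^ 2 * c.M * α₀ + ω))) ∧
          ((L : ℝ) ^ j * η) * ‖covDerivFwd η (1 : Site d → Fin d →
          𝔸ˣ) b.2 lam b.1‖ ≤ (8 * B₀' * (5 * (d : ℝ) * L * B₀) * (((L : ℝ) ^ 3 * α₀) + (6 * d * (L : ℝ) ^ 2 * c.M * α₀ + ω)))) ∧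
        IsLandau138WZ L 1 η (c.sq 0) (c.lamST 1) (1 : Site d → Fin d → 𝔸ˣ) (mgauge (1 : Site d → Fin d →
          𝔸ˣ) v⁻¹ (gaugeAct h (cutFixedZ L (tLo c.a c.ρ) (tHi c.a c.M c.ρ) U₀ c.k (ctr c.a c.M)))) ∧ Restr129Z L 1 (c.lamST 1) (1 : Site d → Fin d → 𝔸ˣ) ((1 : Site d →
          𝔸ˣ) * v))) →
      ((∀ m, 1 ≤ m → m < c.k → ∀ (u₁ : Site d → 𝔸ˣ) (U₁ : Site d → Fin d → 𝔸ˣ) (A : Site d → Fin d → 𝔸),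
        (∀ x, u₁ x ∈ G) → (∀ x, x ∉ c.sq 0 → u₁ x = 1) → mgauge (1 : Site d → Fin d →
          𝔸ˣ) u₁ U₁ = (gaugeAct h (cutFixedZ L (tLo c.a c.ρ) (tHi c.a c.M c.ρ) U₀ c.k (ctr c.a c.M))) → Restr129Z L m (c.lamST m) (1 : Site d → Fin d → 𝔸ˣ) u₁ →
        IsLandau138WZ L m η (c.sq 0) (c.lamST m) (1 : Site d → Fin d → 𝔸ˣ) U₁ →
        (∀ j, j ≤ m → ∀ b ∈ {b : Site d × Fin d | SideTouches (c.sq j) b.1 b.2},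
        U₁ b.1 b.2 = cfgExp η A b.1 b.2 ∧ IsSelfAdjoint (A b.1 b.2) ∧
          ‖A b.1 b.2‖ ≤ (5 * (d : ℝ) * L * B₀ * (((L : ℝ) ^ 3 * α₀) + (6 * d * (L : ℝ) ^ 2 * c.M * α₀ + ω))) * ((L : ℝ) ^ j * η)⁻¹) →
        ∃ (v : Site d → 𝔸ˣ) (lam : Site d → 𝔸), (∀ x, v x ∈ G) ∧ (∀ x, x ∉ c.sq 0 → v x = 1) ∧
        (∀ j, j ≤ m + 1 →
          ∀ b ∈ {b : Site d × Fin d | SideTouches (c.sq j) b.1 b.2}, (v b.1 : 𝔸) = ((gaugeExp lam b.1 : 𝔸ˣ) : 𝔸) ∧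
        (v (b.1 + e b.2) : 𝔸) = ((gaugeExp lam (b.1 + e b.2) : 𝔸ˣ) : 𝔸)) ∧
        (∀ j, j ≤ m + 1 → ∀ b ∈ {b : Site d × Fin d | SideTouches (c.sq j) b.1 b.2},
        ‖lam b.1‖ ≤ (8 * B₀' * (5 * (d : ℝ) * L * B₀) * (((L : ℝ) ^ 3 * α₀) + (6 * d * (L : ℝ) ^ 2 * c.M * α₀ + ω))) ∧
          ((L : ℝ) ^ j * η) * ‖covDerivFwd η (1 : Site d → Fin d →
          𝔸ˣ) b.2 lam b.1‖ ≤ (8 * B₀' * (5 * (d : ℝ) * L * B₀) * (((L : ℝ) ^ 3 * α₀) + (6 * d * (L : ℝ) ^ 2 * c.M * α₀ + ω)))) ∧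
        IsLandau138WZ L (m + 1) η (c.sq 0) (c.lamST (m + 1)) (1 : Site d → Fin d → 𝔸ˣ) (mgauge (1 : Site d → Fin d →
          𝔸ˣ) v⁻¹ U₁) ∧ Restr129Z L (m + 1) (c.lamST (m + 1)) (1 : Site d → Fin d → 𝔸ˣ) (u₁ * v))) →
      ((∀ m, 1 ≤ m → m ≤ c.k → ∀ (u : Site d → 𝔸ˣ) (W : Site d → Fin d → 𝔸ˣ) (A' : Site d → Fin d → 𝔸),
        (∀ x, u x ∈ unitaryUnits 𝔸) → (∀ x, x ∉ c.sq 0 → u x = 1) →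
          mgauge (1 : Site d → Fin d → 𝔸ˣ) u W = (gaugeAct h (cutFixedZ L (tLo c.a c.ρ) (tHi c.a c.M c.ρ) U₀ c.k (ctr c.a c.M))) →
          Restr129Z L m (c.lamST m) (1 : Site d → Fin d → 𝔸ˣ) u →
          IsLandau138WZ L m η (c.sq 0) (c.lamST m) (1 : Site d → Fin d → 𝔸ˣ) W →
        (∀ y τ, IsSelfAdjoint (A' y τ)) →
        (∀ j, j ≤ m → ∀ y τ, SideTouches (c.sq j) y τ →
        W y τ = cfgExp η A' y τ ∧
          ‖A' y τ‖ ≤ (2 * (L * (5 * (d : ℝ) * L * B₀ * (((L : ℝ) ^ 3 * α₀) + (6 * d * (L : ℝ) ^ 2 * c.M * α₀ + ω)))) + 8 * (8 * B₀' * (5 * (d : ℝ) * L * B₀) * (((L : ℝ) ^ 3 * α₀) + (6 * d * (L : ℝ) ^ 2 * c.M * α₀ + ω)))) * ((L : ℝ) ^ j * η)⁻¹) →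
        (∀ y τ, (∀ j, j ≤ m → ¬ SideTouches (c.sq j) y τ) → A' y τ = 0) →
        msup L m η (-(1 : ℝ)) (fun j (b : Site d × Fin d) => SideTouches (c.sq j) b.1 b.2) (fun b => A' b.1 b.2)
        ≤ B₀ * (bondNorm L m η (-(3 : ℝ)) c.sq (fun x μ => Jcur η (1 : Site d → Fin d → 𝔸ˣ) A' μ x)
        + wsup 1 (fun p : {p : ℕ × (Site d × Fin d) // p.1 ≤ m ∧ (p.2 ∈ c.lamBPT m p.1 ∨ (p.1 = 0 ∧ CrossB (c.sq 0) p.2))} =>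
        linCovIterZ L (1 : Site d → Fin d → 𝔸ˣ) (iEta η A') p.1.1 p.1.2.1 p.1.2.2))
        + Bbd * msup L m η (-(1 : ℝ)) (fun j (b : Site d × Fin d) => j = 0 ∧ SideTouches (c.sq 0) b.1 b.2 ∧
            ¬ BondTouches (c.sq 0) b.1 b.2) (fun b => A' b.1 b.2) ∧
        msup L m η (-(2 : ℝ)) (fun j (t : Fin d × Fin d × Site d) => SideTouches (c.sq j) t.2.2 t.2.1)
        (fun t => covDerivFwd η (1 : Site d → Fin d → 𝔸ˣ) t.1 (fun z => A' z t.2.1) t.2.2)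
        ≤ B₀ * (bondNorm L m η (-(3 : ℝ)) c.sq (fun x μ => Jcur η (1 : Site d → Fin d → 𝔸ˣ) A' μ x)
        + wsup 1 (fun p : {p : ℕ × (Site d × Fin d) // p.1 ≤ m ∧ (p.2 ∈ c.lamBPT m p.1 ∨ (p.1 = 0 ∧ CrossB (c.sq 0) p.2))} =>
        linCovIterZ L (1 : Site d → Fin d → 𝔸ˣ) (iEta η A') p.1.1 p.1.2.1 p.1.2.2))
        + Bbd * msup L m η (-(1 : ℝ)) (fun j (b : Site d × Fin d) => j = 0 ∧ SideTouches (c.sq 0) b.1 b.2 ∧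
            ¬ BondTouches (c.sq 0) b.1 b.2) (fun b => A' b.1 b.2))) →
      ∃ u : Site d → 𝔸ˣ, (∀ x, u x ∈ G) ∧ (∀ x, x ∉ c.sq 0 → u x = 1) ∧
        Restr129Z L c.k c.lamS (1 : Site d → Fin d → 𝔸ˣ) u ∧
        IsLandau138WZ L c.k η (c.sq 0) c.lamS (1 : Site d → Fin d → 𝔸ˣ)
          (gaugeAct u⁻¹ (gaugeAct h (cutFixedZ L (tLo c.a c.ρ) (tHi c.a c.M c.ρ) U₀ c.k (ctr c.a c.M)))) ∧
        (∀ j, j ≤ c.k → ∀ b ∈ {b : Site d × Fin d | SideTouches (c.sq j) b.1 b.2},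
          gaugeAct u⁻¹ (gaugeAct h (cutFixedZ L (tLo c.a c.ρ) (tHi c.a c.M c.ρ) U₀ c.k (ctr c.a c.M))) b.1 b.2 =
              cfgExp η (logCfg η (gaugeAct u⁻¹ (gaugeAct h (cutFixedZ L (tLo c.a c.ρ) (tHi c.a c.M c.ρ) U₀ c.k (ctr c.a c.M))))) b.1 b.2 ∧
            IsSelfAdjoint (logCfg η (gaugeAct u⁻¹ (gaugeAct h (cutFixedZ L (tLo c.a c.ρ) (tHi c.a c.M c.ρ) U₀ c.k (ctr c.a c.M)))) b.1 b.2) ∧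
            ‖logCfg η (gaugeAct u⁻¹ (gaugeAct h (cutFixedZ L (tLo c.a c.ρ) (tHi c.a c.M c.ρ) U₀ c.k (ctr c.a c.M)))) b.1 b.2‖ ≤
              (5 * (d : ℝ) * L * B₀ * ((L : ℝ) ^ 3 * α₀ + (6 * d * (L : ℝ) ^ 2 * c.M * α₀ + ω))) * ((L : ℝ) ^ j * η)⁻¹) ∧
        (∀ x, ((localGaugeZ L (tLo c.a c.ρ) (tHi c.a c.M c.ρ) U₀ c.k (ctr c.a c.M))⁻¹ * (h⁻¹ * u)) x ∈ G) ∧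
        AgreeOn (B8Ineq130Rec.tlo L (tLo c.a c.ρ) c.k) (B8Ineq130Rec.thi L (tHi c.a c.M c.ρ) c.k)
          (gaugeAct ((localGaugeZ L (tLo c.a c.ρ) (tHi c.a c.M c.ρ) U₀ c.k (ctr c.a c.M))⁻¹ * (h⁻¹ * u))⁻¹ U₀)
          (gaugeAct u⁻¹ (gaugeAct h (cutFixedZ L (tLo c.a c.ρ) (tHi c.a c.M c.ρ) U₀ c.k (ctr c.a c.M)))) := by
  have hL1 : 1 ≤ L := by omega
  have hL : 2 ≤ L := by omega
  have hLo : Odd L := ⟨s, hLs⟩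
  have hd1 : 1 ≤ d := le_trans (by norm_num) hd2
  obtain ⟨c₁, hc₁, H⟩ := thm4Exists_concrete_at_γ_mem (𝔸 := 𝔸) hd2 hLs hs G hG hB₀ hB₀' hB hBbd hBd
  refine ⟨c₁, hc₁, ?_⟩
  intro η hη K Ω c U₀ hU₀G α₀ hα hα3 hα2 hA hsmall h hhG X hconst ω hω hoscj hosc0 hc P5base₁ P5step₁ H59Dβ₁
  have hU₀ : ∀ x κ, U₀ x κ ∈ unitaryUnits 𝔸 := fun x κ => hG (hU₀G x κ)
  have hh : ∀ x, h x ∈ unitaryUnits 𝔸 := fun x => hG (hhG x)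
  have hk : 1 ≤ c.k := c.one_le_k
  have hρ : 1 ≤ c.ρ := hL1.trans c.L_le_ρ
  have hM1 : 1 ≤ c.M := hρ.trans c.ρ_le_M
  have hLpos : (0 : ℝ) < L := by exact_mod_cast lt_of_lt_of_le (by norm_num) hL
  have hdpos : (0 : ℝ) < d := by exact_mod_cast hd1
  have hMpos : (0 : ℝ) < c.M := by exact_mod_cast hM1
  have hα₀' : 0 < (L : ℝ) ^ 3 * α₀ := by positivity
  have hα₁' : 0 < 6 * (d : ℝ) * (L : ℝ) ^ 2 * c.M * α₀ + ω := by positivity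
  obtain ⟨hmem, h33, h34, hAx, h135, h66⟩ :=
    thm4_hypotheses_one_precomposed_dented_γ hLs hs hd1 c U₀ hU₀ hα hα3 hα2 hη hA hsmall h hh X hconst hoscj hosc0
  have hone : ∀ x κ, (1 : Site d → Fin d → 𝔸ˣ) x κ ∈ unitaryUnits 𝔸 := fun _ _ => (unitaryUnits 𝔸).one_mem
  obtain ⟨u, hu, huS, h129, hLan, h162⟩ := H η hη c.k c.sq (hΩ_sq c hLo) c.lamST c.lamBPT (lamBPT_hbox_pred c hLs) (lamBPT_hclass c hLs)
    (bdryLayer_dented c hLs hs) _ _ hα₀' hα₁' hc 1 _ hone hmem h33 h34 hAx h135 h66 P5base₁ P5step₁ H59Dβ₁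
  simp only [mgauge_one_left] at hLan h162
  have htop : c.lamST c.k = c.lamS := funext (lamST_top_apply c)
  rw [htop] at h129 hLan
  have hΩ' : ∃ l, l ≤ c.k ∧ c.k ≤ l + 1 ∧ ∀ x, InBox (B8Ineq130Rec.tlo L (tLo c.a c.ρ) c.k) (B8Ineq130Rec.thi L (tHi c.a c.M c.ρ) c.k) x → x ∈ Ω l :=
    ⟨c.k - 1, Nat.sub_le _ _, by omega, fun x hx => c.tcube_sub hx⟩
  have hvG : ∀ x, localGaugeZ L (tLo c.a c.ρ) (tHi c.a c.M c.ρ) U₀ c.k (ctr c.a c.M) x ∈ G :=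
    localGaugeZ_mem hLs hL hGavg c.k U₀ hU₀G hα hα3 hα2 (tLo_le_tHi hM1)
      (pdevOn_lt_of_inAk_box hL1 hα hA hΩ') (ctr c.a c.M)
  -- (1.135)′: `U₀^{(v⁻¹h⁻¹u)⁻¹} = ((U₀″)^h)^{u⁻¹}` on `□̃`
  have h135' := agree135 (B8Ineq130Rec.tlo L (tLo c.a c.ρ) c.k) (B8Ineq130Rec.thi L (tHi c.a c.M c.ρ) c.k) U₀
    (localGaugeZ L (tLo c.a c.ρ) (tHi c.a c.M c.ρ) U₀ c.k (ctr c.a c.M)) (h⁻¹ * u)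
  have hmul : gaugeAct (h⁻¹ * u)⁻¹ (cutFixedZ L (tLo c.a c.ρ) (tHi c.a c.M c.ρ) U₀ c.k (ctr c.a c.M)) =
      gaugeAct u⁻¹ (gaugeAct h (cutFixedZ L (tLo c.a c.ρ) (tHi c.a c.M c.ρ) U₀ c.k (ctr c.a c.M))) := by
    rw [mul_inv_rev, inv_inv, gaugeAct_mul]
  rw [hmul] at h135'
  exact ⟨u, hu, huS, h129, hLan hk, h162,
    fun x => G.mul_mem (G.inv_mem (hvG x)) (G.mul_mem (G.inv_mem (hhG x)) (hu x)),
    h135'⟩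

#print axioms prop6_exists_dentedMember_precomposed_at_γ₃_mem

end Literature.MathematicalPhysics.QuantumFieldTheory.Balaban1983to89.B8Prop6DentedCubeMemberGammaGPrecompRec
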